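import Literature.AlgebraicGeometry.HodgeTheory.DivisorSemiregularityMapNormalSheaf
import Literature.AlgebraicGeometry.HodgeTheory.ZeroSchemeNormalSheaf
import HarnessLib

/-!
# The semiregularity map of the zero scheme of a regular section of a line bundle,
# `π : Hⁿ(Z(t), 𝒩_{Z(t)/X}) → Hⁿ⁺¹(X, 𝒪_X)`, with no extra datum (Bloch (1.1) + Fulton B.6.3 / Ex. 6.3.4 (a))

Layer `Literature/AlgebraicGeometry/HodgeTheory` (literature-typing tranche LT-H1 «semiregularity consumers», cell
`pub-hsemireg`, width seat lit-4 g7, FILE 4). ASSEMBLY, everything PROVED: two definitions with bodies and theorems, no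
named fact, no `instance`, no notation, no `sorry` (D-0026: net debt 0).

The tree's `HodgeTheory/DivisorSemiregularityMapNormalSheaf` (FILE 3) types Bloch's (1.1) «the semi-regularity map
`π : H¹(Z, N) → H²(X, O_X)` arises as the boundary map in the cohomology sequence associated to `0 → O_X → O_X(Z) → N → 0`»
for a closed immersion `ι` with `ι.ker = zeroSchemeIdeal 𝓛 t` GIVEN an identification `φ : 𝒩_{Z/X} ≅ ι^*𝓛` as a datum; the
tree's `HodgeTheory/ZeroSchemeNormalSheaf` (Fulton, *Intersection Theory*, Ex. 6.3.4 (a): «`N_X Y` is the restriction of `E`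
to `X`») PRODUCES such an identification for the canonical immersion `zeroSchemeι 𝓛 t : Z(t) ⟶ X` of a section with weakly
regular frame coordinates. This file composes the two for a LINE BUNDLE `𝓛` (`HasRank 𝓛 1`) on a locally Noetherian `X`:

* `zeroSchemeNormalIso hL1 hL t h : normalSheaf (zeroSchemeι 𝓛 t) ≅ (zeroSchemeι 𝓛 t)^*𝓛` — a CHOSEN witness
  (`Classical.choice` on `nonempty_normalSheaf_zeroSchemeι_iso_pullback`; the statements below do not depend on the choice:
  injectivity ∕ surjectivity ∕ exactness are invariant under `Hⁿ` of an isomorphism, FILE 3 §3);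
* **`zeroSchemeSemiregularityMap hL1 hL t h n : Hⁿ(Z(t), 𝒩_{Z(t)/X}) →+ Hⁿ⁺¹(X, 𝒪_X)`** — Bloch's `π` of the divisor
  `Z(t)` (`n = 1`), `:= divisorSemiregularityMap (zeroSchemeι 𝓛 t) hL t (ker_zeroSchemeι L t) h (zeroSchemeNormalIso …) n`;
* the readings of FILE 3 with no datum left: `ker π = im (Hⁿ(X, 𝓛) → Hⁿ(Z(t), 𝒩))`; `π` injective ⟺ `Hⁿ(t) : Hⁿ(X, 𝒪_X) →
  Hⁿ(X, 𝓛)` onto ⟺ `Hⁿ(X, 𝓛) → Hⁿ(Z(t), 𝒩)` zero; `Hⁿ(X, 𝓛) = 0 ⇒ π` injective («`H¹(X, 𝒪_X(Z)) = 0 ⇒ Z` semi-regular»);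
  `π` onto ⟺ `Hⁿ⁺¹(t) = 0`; `Hⁿ⁺¹(X, 𝓛) = 0 ⇒ π` onto.

Hypothesis `(h)` is FILE 1's: near EVERY point of `X` the (single) frame coordinate of `t` in some rank-one frame is a
non-zero-divisor on an affine neighbourhood (effective Cartier divisor); it implies `ZeroSchemeNormalSheaf`'s hypothesis
(the same at the points of `Z(t)`). HONEST SCOPE: as FILE 3 — no identification with the forms-side `IsBlochSemiregular i n 1`,
no Hilbert-scheme statement, ground scheme arbitrary locally Noetherian; `𝓛` of rank one only (Fulton's statement is for
any rank `d`, where `Z(s)` has codimension `d` and (1.1) is not the relevant sequence). -- TODO(general form): none intended.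

* Searched (tree + Mathlib pin): no map `normalSheafCohomology (zeroSchemeι _ _) _ →+ _` in the tree; FILE 3's
  `divisorSemiregularityMap` takes `φ` as a datum. Nothing restated.
-/

noncomputable section

-- `TopCat.Presheaf`/`Scheme.Modules` are not reducible (as in Mathlib's `AlgebraicGeometry/Modules/Sheaf.lean` and the
-- tree's `Motives/ClosedSubschemeRestrictionSequence.lean`).
set_option backward.isDefEq.respectTransparency false

open CategoryTheory Limits Opposite TopologicalSpace Abelian AlgebraicGeometry

universe u

namespace Literature.AlgebraicGeometry.HodgeTheory

open Literature.AlgebraicGeometry.Modules Literature.AlgebraicGeometry.Motives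

variable {X : Scheme.{u}} [IsLocallyNoetherian X] {L : X.Modules} {I : Type u} [Fintype I]
  (hL1 : HasRank L 1) (hL : IsFiniteLocallyFree L) (t : Γ(L, ⊤))
  (h : ∀ x : X, ∃ (V : X.affineOpens) (W : X.Opens) (k : (V : X.Opens) ⟶ W)
    (e : SheafOfModules.free I ≅ L.over W) (σ : Fin 1 ≃ I),
    x ∈ (V : X.Opens) ∧
      RingTheory.Sequence.IsWeaklyRegular Γ(X, (V : X.Opens)) (List.ofFn fun j => coord e k (resTop L t V) (σ j)))

/-- **A chosen identification `𝒩_{Z(t)/X} ≅ 𝓛|_{Z(t)}`** for the zero scheme of a section of a line bundle with regular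
frame coordinates («`N_X Y` is the restriction of `E` to `X`»; `Classical.choice` on the tree's
`nonempty_normalSheaf_zeroSchemeι_iso_pullback`). Definition with body. [cite: Fulton1998, Example 6.3.4 (a) (PDF p. 103)]
[cite: Bloch1972Semiregularity, (1.1) Proposition, p. 52] -/
def zeroSchemeNormalIso :
    normalSheaf (zeroSchemeι L t) ≅ (Scheme.Modules.pullback (zeroSchemeι L t)).obj L :=
  Classical.choice
    (nonempty_normalSheaf_zeroSchemeι_iso_pullback hL1 (isAffineLocalizing_dual_of_isFiniteLocallyFree hL) t
      fun z => h ((zeroSchemeι L t).base z))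

/-- **The semiregularity map of the divisor `Z(t)` of a section of a line bundle**,
`π : Hⁿ(Z(t), 𝒩_{Z(t)/X}) → Hⁿ⁺¹(X, 𝒪_X)` — «the semi-regularity map `π : H¹(Z, N) → H²(X, O_X)` arises as the boundary
map in the cohomology sequence associated to `0 → O_X → O_X(Z) → N → 0`» (`n = 1`; every `n` typed): FILE 3's
`divisorSemiregularityMap` for the canonical immersion `zeroSchemeι 𝓛 t` (`ker = zeroSchemeIdeal 𝓛 t`, tree
`ker_zeroSchemeι`) and the identification `zeroSchemeNormalIso`. Definition with body.
[cite: Bloch1972Semiregularity, (1.1) Proposition, p. 52] [cite: Hartshorne2010, Ex. 6.7 (b), p. 52]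
[cite: Fulton1998, Example 6.3.4 (a) (PDF p. 103)] -/
def zeroSchemeSemiregularityMap (n : ℕ) :
    normalSheafCohomology (zeroSchemeι L t) n →+
      Sheaf.H ((SheafOfModules.toSheaf X.ringCatSheaf).obj (unitModule X)) (n + 1) :=
  haveI := isClosedImmersion_zeroSchemeι L t
  divisorSemiregularityMap (zeroSchemeι L t) hL t (ker_zeroSchemeι L t) h (zeroSchemeNormalIso hL1 hL t h) n

/-- Unfolding `zeroSchemeSemiregularityMap`. [cite: Bloch1972Semiregularity, (1.1) Proposition, p. 52] -/
theorem zeroSchemeSemiregularityMap_eq (n : ℕ) :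
    zeroSchemeSemiregularityMap hL1 hL t h n =
      haveI := isClosedImmersion_zeroSchemeι L t
      divisorSemiregularityMap (zeroSchemeι L t) hL t (ker_zeroSchemeι L t) h (zeroSchemeNormalIso hL1 hL t h) n :=
  rfl

/-- **Exactness at `Hⁿ(Z(t), 𝒩)`**: `ker π` is the image of the restriction `Hⁿ(X, 𝓛) → Hⁿ(Z(t), 𝒩_{Z(t)/X})`
(«`⋯ → H¹(𝓛) → H¹(𝓛_Y) →^δ H²(𝒪_X) → ⋯`»). [cite: Bloch1972Semiregularity, (1.1) Proposition, p. 52]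
[cite: Hartshorne2010, Ex. 6.7 (b), p. 52] -/
theorem exact_restrictNormalCohomology_zeroSchemeSemiregularityMap (n : ℕ) :
    haveI := isClosedImmersion_zeroSchemeι L t
    Function.Exact (restrictNormalCohomology (zeroSchemeι L t) (zeroSchemeNormalIso hL1 hL t h) n)
      (zeroSchemeSemiregularityMap hL1 hL t h n) :=
  haveI := isClosedImmersion_zeroSchemeι L t
  exact_restrictNormalCohomology_divisorSemiregularityMap _ hL t _ h _ n

/-- **Exactness at `Hⁿ⁺¹(X, 𝒪_X)`**: the image of `π` is the kernel of `Hⁿ⁺¹(t) : Hⁿ⁺¹(X, 𝒪_X) → Hⁿ⁺¹(X, 𝓛)`.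
[cite: Bloch1972Semiregularity, (1.1) Proposition, p. 52] [cite: Hartshorne2010, Ex. 6.7 (b), p. 52] -/
theorem exact_zeroSchemeSemiregularityMap_mulSectionCohomology (n : ℕ) :
    Function.Exact (zeroSchemeSemiregularityMap hL1 hL t h n) (mulSectionCohomology L t (n + 1)) :=
  haveI := isClosedImmersion_zeroSchemeι L t
  exact_divisorSemiregularityMap_mulSectionCohomology _ hL t _ h _ n

/-- **«`Z` is semi-regular iff `π` is injective», read on the sequence, for `Z = Z(t)`: `π` is injective iff
`Hⁿ(t) : Hⁿ(X, 𝒪_X) → Hⁿ(X, 𝓛)` is surjective** (`n = 1`: `Z(t)` is semi-regular iff `H¹(X, 𝒪_X) → H¹(X, 𝓛)` is onto).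
[cite: Bloch1972Semiregularity, §0 p. 51 (definition) and (1.1) Proposition, p. 52] [cite: Hartshorne2010, Ex. 6.7 (b), p. 52] -/
theorem zeroSchemeSemiregularityMap_injective_iff_mulSectionCohomology_surjective (n : ℕ) :
    Function.Injective (zeroSchemeSemiregularityMap hL1 hL t h n) ↔
      Function.Surjective (mulSectionCohomology L t n) :=
  haveI := isClosedImmersion_zeroSchemeι L t
  divisorSemiregularityMap_injective_iff_mulSectionCohomology_surjective _ hL t _ h _ n

/-- **`π` is injective iff the restriction `Hⁿ(X, 𝓛) → Hⁿ(Z(t), 𝒩_{Z(t)/X})` is zero** (Kodaira–Spencer's form of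
semi-regularity, `n = 1`). [cite: Bloch1972Semiregularity, (1.1) Proposition, p. 52 and p. 53 lines 1–2]
[cite: Hartshorne2010, Ex. 6.7 (b), p. 52] -/
theorem zeroSchemeSemiregularityMap_injective_iff_restrictNormalCohomology_eq_zero (n : ℕ) :
    haveI := isClosedImmersion_zeroSchemeι L t
    Function.Injective (zeroSchemeSemiregularityMap hL1 hL t h n) ↔
      restrictNormalCohomology (zeroSchemeι L t) (zeroSchemeNormalIso hL1 hL t h) n = 0 :=
  haveI := isClosedImmersion_zeroSchemeι L t
  divisorSemiregularityMap_injective_iff _ hL t _ h _ n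

/-- **`Hⁿ(X, 𝓛) = 0 ⇒ π` injective** (`n = 1`: «if `H¹(X, 𝒪_X(Z)) = 0` then `Z` is semi-regular», for `Z = Z(t)`,
`𝒪_X(Z) = 𝓛`). [cite: Bloch1972Semiregularity, (1.1) Proposition, p. 52 and p. 53 lines 1–2] [cite: Hartshorne2010, Ex. 6.7 (b), p. 52] -/
theorem zeroSchemeSemiregularityMap_injective_of_subsingleton (n : ℕ)
    [Subsingleton (Sheaf.H ((SheafOfModules.toSheaf X.ringCatSheaf).obj L) n)] :
    Function.Injective (zeroSchemeSemiregularityMap hL1 hL t h n) :=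
  haveI := isClosedImmersion_zeroSchemeι L t
  divisorSemiregularityMap_injective_of_subsingleton _ hL t _ h _ n

/-- **`π` is surjective iff `Hⁿ⁺¹(t) : Hⁿ⁺¹(X, 𝒪_X) → Hⁿ⁺¹(X, 𝓛)` is zero.** [cite: Bloch1972Semiregularity, (1.1) Proposition, p. 52]
[cite: Hartshorne2010, Ex. 6.7 (b), p. 52] -/
theorem zeroSchemeSemiregularityMap_surjective_iff (n : ℕ) :
    Function.Surjective (zeroSchemeSemiregularityMap hL1 hL t h n) ↔ mulSectionCohomology L t (n + 1) = 0 :=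
  haveI := isClosedImmersion_zeroSchemeι L t
  divisorSemiregularityMap_surjective_iff _ hL t _ h _ n

/-- **`Hⁿ⁺¹(X, 𝓛) = 0 ⇒ π` surjective.** [cite: Bloch1972Semiregularity, (1.1) Proposition, p. 52]
[cite: Hartshorne2010, Ex. 6.7 (b), p. 52] -/
theorem zeroSchemeSemiregularityMap_surjective_of_subsingleton (n : ℕ)
    [Subsingleton (Sheaf.H ((SheafOfModules.toSheaf X.ringCatSheaf).obj L) (n + 1))] :
    Function.Surjective (zeroSchemeSemiregularityMap hL1 hL t h n) :=
  haveI := isClosedImmersion_zeroSchemeι L t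
  divisorSemiregularityMap_surjective_of_subsingleton _ hL t _ h _ n

end Literature.AlgebraicGeometry.HodgeTheory

end
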